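import Mathlib
import Summits.Ventures.HodgeRepro.Tier4.Line4.ArchApprox
import Summits.Ventures.HodgeRepro.Tier4.Line4.L1ClassWall

/-!
# Tier4/Line4/ArchApproxGlue — C-L4-ARCHAPPROX, consumer glue: the bridge from `IsArchCoeff` + `KTypeData` by name,
and the right invariance of the archimedean torus measure from commutativity

Blind re-derivation cell `pub-hodge-repro`, Tier 4 «prove the step» (README §9–§10), seat t4-L1-p1 (prover, LINE L1,
gen 4; glue for the consumers of ArchApprox p703330).  Tree path
`lean/Summits/Ventures/HodgeRepro/Tier4/Line4/ArchApproxGlue.lean`.  Mathlib-level; no literature.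

WHAT IS PROVED (every declaration sorry-free, axioms `[propext, Classical.choice, Quot.sound]`).
* `isMulRightInvariant_torusInf'_of_comm` — a left-invariant measure on `T′_∞` is right-invariant when `T′` is
  commutative (the shape of `torusT'_seesaw_comm` on the seesaw plane): discharges the binder
  `[νinf'.IsMulRightInvariant]` of ArchApprox's bridge for a Haar measure on the compact abelian `T′_∞`.
* `exists_infFactor_of_isArchCoeff` — the bridge with its inputs taken BY NAME from the line's objects: `IsArchCoeff`'s
  `cont` / `infOnly` / `arch_ne` and `KTypeData`'s `matchT'` (the wall's `_hchi'`), so the (7b) assembler binds one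
  theorem: for the line's `finf` there is an `N`-independent archimedean test `e` (`IsInfFactor`, right-`(T′_w, −e′)`-
  equivariant = `TailFamily.equiv₂`'s shape) with `archFactor (finf ⋆ e) γ₀ ≠ 0`.

Junk: as in ArchApprox (`finf = 0` / `ν′ = 0` excluded by `arch_ne`).

Nothing here says anything about the status of the Hodge conjecture for CM abelian varieties, which is NOT proved
(HC_CM is NOT proved by anyone in this repository).
-/

set_option autoImplicit false
noncomputable section
namespace Summit.Ventures.HodgeRepro.Tier4.Line4
open Summit.Ventures.HodgeRepro.Tier4 Summit.Ventures.HodgeRepro.Tier4.Common Summit.Ventures.HodgeRepro.Tier4.Line1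
  Summit.Ventures.HodgeRepro.Tier4.Line4.L1Class MeasureTheory NumberField
open scoped ComplexConjugate Topology Pointwise

section ArchApproxGlue

variable {k : Type} [Field k] [NumberField k] (W : PlaneData k) [MeasurableSpace (GA W)] [BorelSpace (GA W)]

omit [BorelSpace (GA W)] in
/-- **right invariance of a left-invariant measure on `T′_∞` from the commutativity of `T′`** (the hypothesis in the
shape of `torusT'_seesaw_comm`): `t ↦ t c` and `t ↦ c t` are the same map. -/
theorem isMulRightInvariant_torusInf'_of_comm
    (hcomm : ∀ s t : GA W, s ∈ torusT' W → t ∈ torusT' W → s * t = t * s)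
    (ν : Measure (torusInf' W)) [ν.IsMulLeftInvariant] : ν.IsMulRightInvariant := by
  refine ⟨fun c => ?_⟩
  have h : (fun t : torusInf' W => t * c) = fun t => c * t := by
    funext t
    apply Subtype.ext
    apply Subtype.ext
    exact hcomm _ _ (t : torusT' W).2 (c : torusT' W).2
  rw [h]
  exact map_mul_left_eq_self ν c

/-- **the bridge by name** for the line's objects: from `IsArchCoeff` (`cont`, `infOnly`, `arch_ne`) and `KTypeData`
(`matchT'`), an `N`-independent right-`(T′_w, −e′)`-equivariant archimedean test `e` with
`archFactor (finf ⋆ e) γ₀ ≠ 0` (ArchApprox's `exists_infFactor_weightEquivariant_archFactor_convInf_ne_zero`). -/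
theorem exists_infFactor_of_isArchCoeff (S : RTF.Setting (GA W)) (R : RTFData W) (q : QuadData k)
    (g g' : Matrix (Fin 4) (Fin 4) k) (w₀ : InfinitePlace k) (eP eM eP' eM' : InfinitePlace k → ℤ) (γ₀ : GA W)
    (νinf : Measure (torusInf W)) (νinf' : Measure (torusInf' W)) {finf : GA W → ℂ}
    (h : IsArchCoeff W S R q g g' w₀ eP eM eP' eM' γ₀ νinf νinf' finf)
    (D : KTypeData W R q g g' eP eM eP' eM')
    (μinf : Measure (infinitePart W)) [μinf.IsHaarMeasure] [IsFiniteMeasure νinf] [IsFiniteMeasure νinf']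
    [νinf'.IsMulLeftInvariant] [νinf'.IsMulRightInvariant]
    [CompactSpace (torusInf W)] [CompactSpace (torusInf' W)]
    (hc : Continuous R.chi) (hu : ∀ a, ‖R.chi a‖ = 1) (hc' : Continuous R.chi') (hu' : ∀ a, ‖R.chi' a‖ = 1) :
    ∃ e : GA W → ℂ, IsInfFactor W e ∧
      (∀ (w : InfinitePlace k) (κ : GA W), κ ∈ localTorusAt' W w → ∀ x,
        e (x * κ) = weightAt' W q w g g' 0 κ ^ (-eP' w) * weightAt' W q w g g' 1 κ ^ (-eM' w) * e x) ∧
      archFactor W R (convInf W μinf finf e) γ₀ νinf νinf' ≠ 0 :=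
  exists_infFactor_weightEquivariant_archFactor_convInf_ne_zero W R μinf νinf νinf' hc hu hc' hu' q g g' eP' eM'
    D.matchT' h.cont h.infOnly γ₀ h.arch_ne

end ArchApproxGlue

end Summit.Ventures.HodgeRepro.Tier4.Line4

end
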